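import Summits.Ventures.PercRepro.ThetaOmegaCoreTypedTwo
import Summits.Ventures.PercRepro.ThetaOmegaCoreT00Two
import Summits.Ventures.PercRepro.ThetaOmegaCoreT00Touch

/-!
# NoMixed is a theorem: a bad edge and a bad two-edge point never coexist

Dossier proofs/MINE1-theoremS.md, Addendum 81 suppl. 2 (mine-1, gen 42). The edge family of a bad
two-edge point `r` is an exceptional pair `{a, b}` (`OmegaExcPair`): `b` is K-mono
(`c0 (b + r) = c1 b`), `a` has `c1 a ≠ c1 b` and is K-mono or `∅`; its credit is exactly the edge
`(∅, {r})` (`badTwo_edges`). Relative to a bad edge `(s, s + q)` at `q ≠ r`: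

* if the bad edge is typed (T10 / T01), `badEdge_typed_no_excTwo` applies;
* if it is of type T00, the two edges of `r` are in general position
  (`t00_badTwo_nondeg_false`), exactly one touches `{s, s + q}` (the four positions of
  `ThetaOmegaCoreT00Touch.lean`), or both touch (`both_touching_false`).

**`noMixed : NoMixed α`**, so the core of (Ω) — and with it (Ω) and (Σ) — now rests on the single
statement `NoThreeTwo` (`omegaCore_of_noThreeTwo`, `conjOmega_of_noThreeTwo`,
`conjSigma_of_noThreeTwo`).
-/

namespace PercRepro.MSTight

open Finset

variable {α : Type*} [DecidableEq α]

section NoMixed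

variable {q r : α} {U : Finset α} {F : Finset (Finset α)} {c0 c1 : Finset α → Bool}
  {s : Finset α}

/-- **The credit of a bad two-edge point is exactly the edge `(∅, {r})`**: every `r`-edge of `A`
has lower end `∅` and `C` has no `r`-edge (given a K-mono edge `b`). -/
theorem badTwo_edges (hr : BadTwo U F c0 c1 r) {b : Finset α} (hbK : b ∈ qEdges r F)
    (hKb : c0 (insert r b) = c1 b) :
    (∀ d ∈ qEdges r (omegaA F c0 c1), d = ∅) ∧ ∀ d, d ∉ qEdges r (omegaC U F c1) := by
  obtain ⟨-, -, -, hcred⟩ := hr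
  have hemptyK : ∅ ∈ omegaA (qEdges r F) (edgeC0 r c0) c1 :=
    empty_mem_omegaA_of_mono hbK hKb
  have hemptyA : ∅ ∈ qEdges r (omegaA F c0 c1) := omegaA_qEdges_subset hemptyK
  have h1 := card_pos.2 ⟨∅, hemptyA⟩
  unfold omegaCredit at hcred
  constructor
  · intro d hd
    exact card_le_one.1 (by omega) d hd ∅ hemptyA
  · intro d hd
    have := card_pos.2 ⟨d, hd⟩
    omega

/-- A third member for the type of the bad edge: one of `b`, `b + r` is outside `{s, s + q}`. -/
theorem exists_third_of_edge (hqr : q ≠ r) (hqs : q ∉ s) {b : Finset α} (hb : b ∈ F) (hrb : r ∉ b)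
    (hvb : insert r b ∈ F) : ∃ w ∈ F, w ≠ s ∧ w ≠ insert q s := by
  by_cases hbs : b = s
  · subst hbs
    refine ⟨insert r b, hvb, fun h => hrb (h ▸ mem_insert_self r b), fun h => ?_⟩
    have : r ∈ insert q b := h ▸ mem_insert_self r b
    rcases mem_insert.1 this with h' | h'
    · exact hqr h'.symm
    · exact hrb h'
  by_cases hbu : b = insert q s
  · subst hbu
    refine ⟨insert r (insert q s), hvb, fun h => hqs (h ▸ mem_insert_of_mem (mem_insert_self q s)),
      fun h => hrb (h ▸ mem_insert_self r _)⟩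
  exact ⟨b, hb, hbs, hbu⟩

/-- **A bad edge of type T00 excludes every bad two-edge point** (the exceptional pair normalised
to `b` K-mono and `a` with `c1 a ≠ c1 b`, K-mono or `∅`). -/
theorem t00_badTwo_false (hq : BadEdge U F c0 c1 q s) (hqr : q ≠ r)
    (hs0 : c0 s = c1 s) (hu0 : c0 (insert q s) = c1 (insert q s))
    (hrU : r ∈ U) (hrA : ∀ d ∈ qEdges r (omegaA F c0 c1), d = ∅)
    (hrC : ∀ d, d ∉ qEdges r (omegaC U F c1)) {a b : Finset α} (hab : a ≠ b)
    (hb : b ∈ F) (hrb : r ∉ b) (hvb : insert r b ∈ F) (hKb : c0 (insert r b) = c1 b)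
    (ha : a ∈ F) (hra : r ∉ a) (hva : insert r a ∈ F) (hKa : c0 (insert r a) = c1 a ∨ a = ∅)
    (hopp : c1 a ≠ c1 b) : False := by
  rcases touch_or_not b s q r with tb | hndb <;> rcases touch_or_not a s q r with ta | hnda
  · exact both_touching_false hq hqr hab ha hra hva hb hrb hvb ta tb
  · -- `b` touches, `a` in general position
    rcases tb with h | h | h | h
    · subst h
      exact touch_lower_eq_false hq hqr hs0 hu0 hrA hrU hrC hrb hvb ha hra hva hopp hnda
    · exact touch_upper_eq_false hq hqr hs0 hu0 hrA hb hrb h (Or.inl hKb) ha hra hva hKa hopp hnda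
    · subst h
      exact touch_lower_eq_upper_false hq hqr hu0 hrA hrU hrC hrb hvb ha hra hva hopp hnda
    · exact touch_upper_eq_upper_false hq hqr hs0 hu0 hrA hb hrb h (Or.inl hKb) (Ne.symm hab)
        ha hra hva hKa hopp hnda
  · -- `a` touches, `b` in general position
    rcases ta with h | h | h | h
    · subst h
      exact touch_lower_eq_false hq hqr hs0 hu0 hrA hrU hrC hra hva hb hrb hvb (Ne.symm hopp) hndb
    · exact touch_upper_eq_false hq hqr hs0 hu0 hrA ha hra h hKa hb hrb hvb (Or.inl hKb)
        (Ne.symm hopp) hndb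
    · subst h
      exact touch_lower_eq_upper_false hq hqr hu0 hrA hrU hrC hra hva hb hrb hvb (Ne.symm hopp)
        hndb
    · exact touch_upper_eq_upper_false hq hqr hs0 hu0 hrA ha hra h hKa hab hb hrb hvb
        (Or.inl hKb) (Ne.symm hopp) hndb
  · exact t00_badTwo_nondeg_false hq hqr hs0 hu0 hrU hrA hrC hb hrb hvb hKb ha hra hva hKa hopp
      hndb hnda

/-- **THEOREM: a bad edge and a bad two-edge point never coexist.** -/
theorem noMixed : NoMixed α := by
  intro U F c0 c1 q r s hq hr hqr
  have hrU := hr.1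
  have h2 := hr.2.1
  have hexc := hr.2.2.1
  obtain ⟨w, w', hww', hK⟩ := card_eq_two.1 h2
  have hwK : w ∈ qEdges r F := by rw [hK]; exact mem_insert_self w {w'}
  have hw'K : w' ∈ qEdges r F := by rw [hK]; exact mem_insert_of_mem (mem_singleton_self w')
  obtain ⟨hw, hrw, hvw⟩ := mem_qEdges.1 hwK
  obtain ⟨hw', hrw', hvw'⟩ := mem_qEdges.1 hw'K
  have hpair : OmegaExcPair (edgeC0 r c0) c1 w w' := by
    by_contra hnot
    have := two_le_omegaCount_of_pair (U := U.erase r) hwK hw'K hww'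
      (fun h => hnot (Or.inl h)) (fun h => hnot (Or.inr (Or.inl h)))
      (fun h => hnot (Or.inr (Or.inr h)))
    omega
  -- normalise the pair to `b` K-mono, `a` with `c1 a ≠ c1 b`
  have hnorm : ∃ a b : Finset α, a ≠ b ∧ b ∈ F ∧ r ∉ b ∧ insert r b ∈ F ∧
      c0 (insert r b) = c1 b ∧ a ∈ F ∧ r ∉ a ∧ insert r a ∈ F ∧
      (c0 (insert r a) = c1 a ∨ a = ∅) ∧ c1 a ≠ c1 b ∧ b ∈ qEdges r F := by
    rcases hpair with ⟨hmw, hmw', hne⟩ | ⟨hw0, hmw', hne⟩ | ⟨hw'0, hmw, hne⟩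
    · exact ⟨w, w', hww', hw', hrw', hvw', hmw', hw, hrw, hvw, Or.inl hmw,
        fun h => hne ((hmw.trans h).trans hmw'.symm), hw'K⟩
    · exact ⟨w, w', hww', hw', hrw', hvw', hmw', hw, hrw, hvw, Or.inr hw0,
        fun h => hne (h.trans hmw'.symm), hw'K⟩
    · exact ⟨w', w, Ne.symm hww', hw, hrw, hvw, hmw, hw', hrw', hvw', Or.inr hw'0,
        fun h => hne (h.trans hmw.symm), hwK⟩
  obtain ⟨a, b, hab, hb, hrb, hvb, hKb, ha, hra, hva, hKa, hopp, hbK⟩ := hnorm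
  obtain ⟨hrA, hrC⟩ := badTwo_edges hr hbK hKb
  -- the type of the bad edge
  obtain ⟨w3, hw3, hw3s, hw3u⟩ := exists_third_of_edge hqr hq.2.2.1 hb hrb hvb
  have hty := badEdge_typed hq hw3 hw3s hw3u
  unfold EdgeTyped at hty
  rcases hty with ⟨h10, -, -⟩ | ⟨h01, -, -⟩ | ⟨hs0, hu0, -⟩
  · exact badEdge_typed_no_excTwo hq (Or.inl h10) hqr h2 hexc
  · exact badEdge_typed_no_excTwo hq (Or.inr h01) hqr h2 hexc
  · exact t00_badTwo_false hq hqr hs0 hu0 hrU hrA hrC hab hb hrb hvb hKb ha hra hva hKa hopp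

/-- **The core of (Ω) from `NoThreeTwo` alone.** -/
theorem omegaCore_of_noThreeTwo (hT : NoThreeTwo α) : OmegaCore α :=
  omegaCore_of_noMixed_noThreeTwo noMixed hT

/-- **(Ω) from `NoThreeTwo` alone.** -/
theorem conjOmega_of_noThreeTwo (hT : NoThreeTwo α) : ConjOmega α :=
  conjOmega_of_core (omegaCore_of_noThreeTwo hT)

/-- **(Σ) from `NoThreeTwo` alone.** -/
theorem conjSigma_of_noThreeTwo [Fintype α] (hT : NoThreeTwo α) : ConjSigma α :=
  conjSigma_of_conjOmega (conjOmega_of_noThreeTwo hT)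

end NoMixed

end PercRepro.MSTight
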